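import Summits.HodgeConjecture.HodgeCM.Model.LiuDictionary
import HarnessLib

/-!
# Δ2 BRIDGE, sub-socket S-d (TRANSPORT FORM) — `Thm418Combined` ∕ `Thm418C` are invariant under transport of ALL their data

Cell pub-hodgecm2 (COR-CM), Δ2 bridge wall-breaker fan, seat wb-10 (prover-pub-hodgecm2-d2bridge-wb-10-g0-0), 2026-08-23;
COORDINATOR «(c)+(d) ESCALATED» (HOME/INBOX l.11452), sub-socket S-d «`Thm418C` symmetry `V@ι₁ ↔ V̄@ῑ₁`», TRANSPORT route.

WHAT IS HERE (kernel only; no instance, no named fact, no new definition, nothing cited anew):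

* §1 (abstract, `HodgeCM.Literature.Theta.LiuAlbaneseModuleDatum` currency).  For two automorphic-side data
  `D : LiuAlbaneseModuleDatum G Kof`, `D' : LiuAlbaneseModuleDatum G' Kof'` and abstract geometric sides `(W, res, cmCl)`,
  `(W', res', cmCl')`, the combined reading `Thm418Combined` ([Liu2021, Thm. 4.18 + (4.3) + Thm. 4.18 (1) + Lem. 2.4 (1)], r8 —
  the BODY of `HodgeCM.Model.LiuDictionary.Thm418C`) TRANSPORTS along a package of maps
  `φ : G → G'`, `eL : Lvl → Lvl'`, `eC : Char → Char'`, `eH : H →ₗ[ℂ] H'`, `eW K : W K →ₗ[ℂ] W' (eL K)` subject to the evident laws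
  (cofinality of `eL`, `Kof' (eL K)` covered by `φ (Kof K)`, `φ`-semilinearity of `eH` on `Kof K`, `PhiMu → PhiMu'`, `eH (block μ) ≤ block' (eC μ)`,
  `eW ∘ res = res' ∘ eH`, `eW K` injective, `cmCl' ⊆ eW '' cmCl`): `thm418Combined_of_transport` (pull-back `D' ⇒ D`, weakest
  one-sided hypotheses), `thm418Combined_transport_of` (push-forward `D ⇒ D'`), `thm418Combined_iff_of_transport` (equivalences);
  with the block law DERIVED from `φ`-semilinear maps of the oscillator modules `ω(μ,ε,χ)` (`map_oscImage_le_of_transport`,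
  `map_block_le_of_transport`, `map_block_eq_of_transport`) and the fixed-vector law `map_mem_fixedBy_of_semilinear`.
* §2 (model currency).  `thm418C_iff_of_transport` ∕ `thm418C_of_transport`: the same for two real-carrier dictionaries
  `T₁ : LiuDictionary hHD hI h₁ h₃ V₁`, `T₂ : LiuDictionary hHD hI h₁ h₃ V₂` at ANY two pins `(L₁, ι₁, V₁)`, `(L₂, ι₂, V₂)` — in
  particular at a conjugate pair `(V, ι₁)`, `(V̄, ῑ₁)` — along `φ : U(V₁)(𝔸_f) ≃* U(V₂)(𝔸_f)`, `eL : Level V₁ ≃o Level V₂`,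
  `eC`, `eH`, and per-level isomorphisms `eW K : H¹(P_K(V₁); ℂ) ≃ H¹(P_{eL K}(V₂); ℂ)` of the complexified cohomology of the REALISED
  pieces `U.pms`, intertwining `res` and matching `cmClasses`; `thm418C_iff_of_transport_refl` = the identity package (joint
  satisfiability of the laws: NON-VACUITY witness).

WHAT THIS SAYS ABOUT S-d (the census is in the seat's NOTES ∕ HOME/INBOX l.11467): S-d «`Thm418C (pin V@ι₁) ↔ Thm418C (pin V̄@ῑ₁)`» IS
`thm418C_iff_of_transport` at `T₁ := liuDictionaryPin … V I line`, `T₂ := liuDictionaryPin … V̄ Ī linē` ONCE the package is built; the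
package EXISTS only for the transposed-conjugate datum `V̄.Hm := V.Hmᵀ`, `Γ̄ := c Γ`, `K̄ := c K` (then `pmsCode L ῑ₁ V̄ Γ̄ = pmsCode L ι₁ V Γ`,
the pieces are the SAME realised surfaces and `eW K` is a cast — wb-5's structural half), and its remaining components (tower
`eH` along `g ↦ c g c⁻¹`-conjugation of `U(V)(𝔸_f)`, the Weil-side relabeling of the index lines giving `hblock`, `PhiMuLine ῑ₁ ↔ PhiMuLine ι₁`
on corresponding lines, `adm` via `isReflexOfTypeG_starRingEnd_comp_iff`) are the typed Stage-1 relabeling obligations — explicit binders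
here, never hypotheses smuggled as facts.  With the SAME Gram matrix at `ῑ₁` the two towers live on independently CHOSEN surfaces
(`pmsRealisation` per `PicardCode`) and no `eW` exists in the tree: S-d is then not a sentence the tree decides.
The theorem is ORIENTATION-NEUTRAL: it relabels the ι₁∕ῑ₁ seam of DECISION #13, it does not remove it (ORIENTATION-MEMO v1.3 §7).
HC_CM is NOT proved; «Δ2 BRIDGE CLOSED» is NOT claimed; nothing here is a claim of the manuscripts under adjudication.

## References
* [Liu2021] Y. Liu, *Fourier–Jacobi cycles and arithmetic relative trace formula*, Camb. J. Math. 9 (2021) = arXiv:2102.11518 —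
  Thm. 4.18 (FJcycle.tex l. 2232–2245), its proof map (4.3), Prop. 4.13 («for every embedding τ'», l. 2113–2119).
-/

set_option autoImplicit false

noncomputable section

namespace HodgeCM.Literature.Theta.LiuAlbaneseModuleDatum.D2Bridge

open HodgeCM.Literature.Theta HodgeCM.Literature.Theta.LiuAlbaneseModuleDatum

universe u v w u' v' w'

/-! ## §1 Abstract transport of `Thm418Combined` -/

section Abstract

/-- **Fixed vectors transport.**  A `ℂ`-linear map `f : M → M'` from a `ℂ[G]`-module to a `ℂ[G']`-module which is `φ`-semilinear on a
subgroup `K ≤ G` (`f (k • x) = φ k • f x`, `k ∈ K`) maps `K`-fixed vectors to `K'`-fixed vectors for every `K' ≤ G'` covered by `φ(K)`. [folklore] -/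
theorem map_mem_fixedBy_of_semilinear {G : Type u} [Group G] {G' : Type u'} [Group G']
    {M : Type v} [AddCommGroup M] [Module ℂ M] [Module (MonoidAlgebra ℂ G) M] [IsScalarTower ℂ (MonoidAlgebra ℂ G) M]
    {M' : Type v'} [AddCommGroup M'] [Module ℂ M'] [Module (MonoidAlgebra ℂ G') M']
    [IsScalarTower ℂ (MonoidAlgebra ℂ G') M']
    (φ : G → G') (f : M →ₗ[ℂ] M') {K : Subgroup G} {K' : Subgroup G'}
    (hK : ∀ k' ∈ K', ∃ k ∈ K, φ k = k')
    (hf : ∀ k ∈ K, ∀ x : M, f (MonoidAlgebra.of ℂ G k • x) = MonoidAlgebra.of ℂ G' (φ k) • f x)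
    {x : M} (hx : x ∈ fixedBy K M) : f x ∈ fixedBy K' M' := by
  intro k' hk'
  obtain ⟨k, hk, rfl⟩ := hK k' hk'
  rw [← hf k hk x, hx k hk]

variable {G : Type u} [Group G] {Lvl : Type v} {Kof : Lvl → Subgroup G}
variable {G' : Type u'} [Group G'] {Lvl' : Type v'} {Kof' : Lvl' → Subgroup G'}

/-- **Isotypic images transport.**  Along a group isomorphism `φ : G ≃* G'` and a `φ`-semilinear `ℂ`-linear map `eH : H → H'`, the
sum `oscImage t` of the equivariant images of `ω(t)` in `H` is carried into `oscImage t'` as soon as `ω(t')` maps `φ⁻¹`-semilinearly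
ONTO `ω(t)` (`θ`): every `ℂ[G]`-map `ψ : ω(t) → H` yields the `ℂ[G']`-map `eH ∘ ψ ∘ θ : ω(t') → H'` with the same image under `eH`
(`MonoidAlgebra.equivariantOfLinearOfComm`). [folklore] -/
theorem map_oscImage_le_of_transport (D : LiuAlbaneseModuleDatum G Kof) (D' : LiuAlbaneseModuleDatum G' Kof')
    (φ : G ≃* G') (eH : D.H →ₗ[ℂ] D'.H)
    (heH : ∀ (g : G) (x : D.H), eH (MonoidAlgebra.of ℂ G g • x) = MonoidAlgebra.of ℂ G' (φ g) • eH x)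
    (t : D.Triple) (t' : D'.Triple) (θ : D'.Ωt t' →ₗ[ℂ] D.Ωt t) (hθ : Function.Surjective θ)
    (hθG : ∀ (g' : G') (y : D'.Ωt t'),
      θ (MonoidAlgebra.of ℂ G' g' • y) = MonoidAlgebra.of ℂ G (φ.symm g') • θ y) :
    (D.oscImage t).map eH ≤ D'.oscImage t' := by
  unfold oscImage
  rw [Submodule.map_iSup]
  refine iSup_le fun ψ => ?_
  have hcomm : ∀ (g' : G') (y : D'.Ωt t'),
      (eH ∘ₗ ψ.restrictScalars ℂ ∘ₗ θ) (MonoidAlgebra.single g' (1 : ℂ) • y) =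
        MonoidAlgebra.single g' (1 : ℂ) • (eH ∘ₗ ψ.restrictScalars ℂ ∘ₗ θ) y := by
    intro g' y
    simp only [LinearMap.coe_comp, Function.comp_apply, LinearMap.coe_restrictScalars]
    rw [← MonoidAlgebra.of_apply, hθG, map_smul, heH, MulEquiv.apply_symm_apply]
  refine le_trans ?_ (le_iSup (fun ψ' : D'.Ωt t' →ₗ[MonoidAlgebra ℂ G'] D'.H => (LinearMap.range ψ').restrictScalars ℂ)
    (MonoidAlgebra.equivariantOfLinearOfComm (eH ∘ₗ ψ.restrictScalars ℂ ∘ₗ θ) hcomm))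
  rintro _ ⟨y, hy, rfl⟩
  obtain ⟨z, rfl⟩ : ∃ z, ψ z = y := hy
  obtain ⟨w, rfl⟩ := hθ z
  exact ⟨w, rfl⟩

/-- **Blocks transport (one-sided).**  `eH (block μ) ≤ block' μ'` as soon as every `ω(μ, a)` is a `φ⁻¹`-semilinear QUOTIENT of some
`ω(μ', a')`. [folklore] -/
theorem map_block_le_of_transport (D : LiuAlbaneseModuleDatum G Kof) (D' : LiuAlbaneseModuleDatum G' Kof')
    (φ : G ≃* G') (eH : D.H →ₗ[ℂ] D'.H)
    (heH : ∀ (g : G) (x : D.H), eH (MonoidAlgebra.of ℂ G g • x) = MonoidAlgebra.of ℂ G' (φ g) • eH x)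
    (μ : D.Char) (μ' : D'.Char)
    (hΩ : ∀ a : D.Adm μ, ∃ (a' : D'.Adm μ') (θ : D'.Ω μ' a' →ₗ[ℂ] D.Ω μ a), Function.Surjective θ ∧
      ∀ (g' : G') (y : D'.Ω μ' a'), θ (MonoidAlgebra.of ℂ G' g' • y) = MonoidAlgebra.of ℂ G (φ.symm g') • θ y) :
    (D.block μ).map eH ≤ D'.block μ' := by
  unfold block
  rw [Submodule.map_iSup]
  refine iSup_le fun a => ?_
  obtain ⟨a', θ, hθ, hθG⟩ := hΩ a
  exact le_trans (map_oscImage_le_of_transport D D' φ eH heH ⟨μ, a⟩ ⟨μ', a'⟩ θ hθ hθG)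
    (le_iSup (fun b : D'.Adm μ' => D'.oscImage ⟨μ', b⟩) a')

/-- **Blocks transport (two-sided).**  Along `φ : G ≃* G'`, a `φ`-semilinear `ℂ`-linear ISOMORPHISM `eH : H ≃ H'`, a bijection of the
admissible completions `eA : Adm μ ≃ Adm' μ'` and `φ`-semilinear isomorphisms `eΩ a : ω(μ, a) ≃ ω(μ', eA a)`, the `μ`-block of `H` is
carried ONTO the `μ'`-block of `H'`. [folklore] -/
theorem map_block_eq_of_transport (D : LiuAlbaneseModuleDatum G Kof) (D' : LiuAlbaneseModuleDatum G' Kof')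
    (φ : G ≃* G') (eH : D.H ≃ₗ[ℂ] D'.H)
    (heH : ∀ (g : G) (x : D.H), eH (MonoidAlgebra.of ℂ G g • x) = MonoidAlgebra.of ℂ G' (φ g) • eH x)
    (μ : D.Char) (μ' : D'.Char) (eA : D.Adm μ ≃ D'.Adm μ')
    (eΩ : ∀ a : D.Adm μ, D.Ω μ a ≃ₗ[ℂ] D'.Ω μ' (eA a))
    (heΩ : ∀ (a : D.Adm μ) (g : G) (y : D.Ω μ a),
      eΩ a (MonoidAlgebra.of ℂ G g • y) = MonoidAlgebra.of ℂ G' (φ g) • eΩ a y) :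
    (D.block μ).map (eH : D.H →ₗ[ℂ] D'.H) = D'.block μ' := by
  apply le_antisymm
  · refine map_block_le_of_transport D D' φ (eH : D.H →ₗ[ℂ] D'.H) (fun g x => heH g x) μ μ'
      fun a => ⟨eA a, ((eΩ a).symm : D'.Ω μ' (eA a) →ₗ[ℂ] D.Ω μ a), (eΩ a).symm.surjective, fun g' y => ?_⟩
    change (eΩ a).symm _ = _ • (eΩ a).symm y
    apply (eΩ a).injective
    rw [LinearEquiv.apply_symm_apply, heΩ, MulEquiv.apply_symm_apply, LinearEquiv.apply_symm_apply]
  · have hsymm : ∀ (g' : G') (x' : D'.H), (eH.symm : D'.H →ₗ[ℂ] D.H) (MonoidAlgebra.of ℂ G' g' • x') =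
        MonoidAlgebra.of ℂ G (φ.symm g') • (eH.symm : D'.H →ₗ[ℂ] D.H) x' := by
      intro g' x'
      change eH.symm _ = _ • eH.symm x'
      apply eH.injective
      rw [LinearEquiv.apply_symm_apply, heH, MulEquiv.apply_symm_apply, LinearEquiv.apply_symm_apply]
    have h1 : (D'.block μ').map (eH.symm : D'.H →ₗ[ℂ] D.H) ≤ D.block μ := by
      refine map_block_le_of_transport D' D φ.symm (eH.symm : D'.H →ₗ[ℂ] D.H) hsymm μ' μ fun a' => ?_
      obtain ⟨a, rfl⟩ := eA.surjective a'
      refine ⟨a, (eΩ a : D.Ω μ a →ₗ[ℂ] D'.Ω μ' (eA a)), (eΩ a).surjective, fun g y => ?_⟩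
      change eΩ a _ = _ • eΩ a y
      rw [heΩ, MulEquiv.symm_symm]
    intro x' hx'
    exact ⟨eH.symm x', h1 ⟨x', hx', rfl⟩, eH.apply_symm_apply x'⟩

/-- **`Thm418Combined` transports (pull-back form, weakest hypotheses).**  If `D'` satisfies the combined reading r8 for
`(res', cmCl')`, so does `D` for `(res, cmCl)`, along any package of maps `D → D'`: `φ : G → G'` covering `Kof' (eL K)` by `φ (Kof K)`,
a cofinal `eL : Lvl → Lvl'`, `eC : Char → Char'` preserving `PhiMu`, a `ℂ`-linear `eH : H → H'` `φ`-semilinear on each `Kof K` and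
carrying `block μ` into `block' (eC μ)`, and injective `eW K : W K → W' (eL K)` with `eW K ∘ res K = res' (eL K) ∘ eH` and
`cmCl' (eL K) (eC μ) ⊆ eW K '' cmCl K μ`.  PROOF: unfold; chase one vector. [folklore] -/
theorem thm418Combined_of_transport [Preorder Lvl] [Preorder Lvl']
    (D : LiuAlbaneseModuleDatum G Kof) (D' : LiuAlbaneseModuleDatum G' Kof')
    {W : Lvl → Type w} [∀ K, AddCommGroup (W K)] [∀ K, Module ℂ (W K)]
    {W' : Lvl' → Type w'} [∀ K', AddCommGroup (W' K')] [∀ K', Module ℂ (W' K')]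
    (res : ∀ K : Lvl, D.H →ₗ[ℂ] W K) (cmCl : ∀ K : Lvl, D.Char → Set (W K))
    (res' : ∀ K' : Lvl', D'.H →ₗ[ℂ] W' K') (cmCl' : ∀ K' : Lvl', D'.Char → Set (W' K'))
    (φ : G → G') (eL : Lvl → Lvl') (eC : D.Char → D'.Char) (eH : D.H →ₗ[ℂ] D'.H)
    (eW : ∀ K : Lvl, W K →ₗ[ℂ] W' (eL K))
    (hcof : ∀ K₀' : Lvl', ∃ K₀ : Lvl, ∀ K ≤ K₀, eL K ≤ K₀')
    (hK : ∀ (K : Lvl), ∀ k' ∈ Kof' (eL K), ∃ k ∈ Kof K, φ k = k')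
    (heH : ∀ (K : Lvl), ∀ k ∈ Kof K, ∀ x : D.H,
      eH (MonoidAlgebra.of ℂ G k • x) = MonoidAlgebra.of ℂ G' (φ k) • eH x)
    (hPhi : ∀ μ : D.Char, D.PhiMu μ → D'.PhiMu (eC μ))
    (hblock : ∀ μ : D.Char, (D.block μ).map eH ≤ D'.block (eC μ))
    (hres : ∀ (K : Lvl) (x : D.H), eW K (res K x) = res' (eL K) (eH x))
    (hW : ∀ K : Lvl, Function.Injective (eW K))
    (hcm : ∀ (K : Lvl) (μ : D.Char), cmCl' (eL K) (eC μ) ⊆ eW K '' cmCl K μ)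
    (h : D'.Thm418Combined res' cmCl') : D.Thm418Combined res cmCl := by
  intro μ hμ
  obtain ⟨K₀', hK₀'⟩ := h (eC μ) (hPhi μ hμ)
  obtain ⟨K₀, hK₀⟩ := hcof K₀'
  refine ⟨K₀, fun K hKle x hxb hxf => ?_⟩
  have h1 : eH x ∈ D'.block (eC μ) := hblock μ ⟨x, hxb, rfl⟩
  have h2 : eH x ∈ fixedBy (Kof' (eL K)) D'.H := map_mem_fixedBy_of_semilinear φ eH (hK K) (heH K) hxf
  have h3 : eW K (res K x) ∈ (Submodule.span ℂ (cmCl K μ)).map (eW K) := by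
    rw [Submodule.map_span, hres]
    exact Submodule.span_mono (hcm K μ) (hK₀' (eL K) (hK₀ K hKle) (eH x) h1 h2)
  obtain ⟨y, hy, hyx⟩ := h3
  rwa [← hW K hyx]

/-- **`Thm418Combined` transports (push-forward form).**  If `D` satisfies the combined reading r8 for `(res, cmCl)`, so does `D'` for
`(res', cmCl')`, along `φ : G → G'` with `φ (Kof K) ≤ Kof' (eL K)`, an order ISOMORPHISM of levels `eL`, a SURJECTION of characters `eC`
reflecting `PhiMu`, a `ℂ`-linear ISOMORPHISM `eH` `φ`-semilinear on each `Kof K` with `block' (eC μ) ≤ eH (block μ)`, and `eW K` with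
`eW K ∘ res K = res' (eL K) ∘ eH`, `eW K '' cmCl K μ ⊆ cmCl' (eL K) (eC μ)`. [folklore] -/
theorem thm418Combined_transport_of [Preorder Lvl] [Preorder Lvl']
    (D : LiuAlbaneseModuleDatum G Kof) (D' : LiuAlbaneseModuleDatum G' Kof')
    {W : Lvl → Type w} [∀ K, AddCommGroup (W K)] [∀ K, Module ℂ (W K)]
    {W' : Lvl' → Type w'} [∀ K', AddCommGroup (W' K')] [∀ K', Module ℂ (W' K')]
    (res : ∀ K : Lvl, D.H →ₗ[ℂ] W K) (cmCl : ∀ K : Lvl, D.Char → Set (W K))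
    (res' : ∀ K' : Lvl', D'.H →ₗ[ℂ] W' K') (cmCl' : ∀ K' : Lvl', D'.Char → Set (W' K'))
    (φ : G → G') (eL : Lvl ≃o Lvl') (eC : D.Char → D'.Char) (hC : Function.Surjective eC)
    (eH : D.H ≃ₗ[ℂ] D'.H) (eW : ∀ K : Lvl, W K →ₗ[ℂ] W' (eL K))
    (hK : ∀ (K : Lvl), ∀ k ∈ Kof K, φ k ∈ Kof' (eL K))
    (heH : ∀ (K : Lvl), ∀ k ∈ Kof K, ∀ x : D.H,
      eH (MonoidAlgebra.of ℂ G k • x) = MonoidAlgebra.of ℂ G' (φ k) • eH x)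
    (hPhi : ∀ μ : D.Char, D'.PhiMu (eC μ) → D.PhiMu μ)
    (hblock : ∀ μ : D.Char, D'.block (eC μ) ≤ (D.block μ).map (eH : D.H →ₗ[ℂ] D'.H))
    (hres : ∀ (K : Lvl) (x : D.H), eW K (res K x) = res' (eL K) (eH x))
    (hcm : ∀ (K : Lvl) (μ : D.Char), eW K '' cmCl K μ ⊆ cmCl' (eL K) (eC μ))
    (h : D.Thm418Combined res cmCl) : D'.Thm418Combined res' cmCl' := by
  intro μ' hμ'
  obtain ⟨μ, rfl⟩ := hC μ'
  obtain ⟨K₀, hK₀⟩ := h μ (hPhi μ hμ')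
  refine ⟨eL K₀, fun K' hK'le x' hxb' hxf' => ?_⟩
  obtain ⟨K, rfl⟩ := eL.surjective K'
  obtain ⟨x, rfl⟩ := eH.surjective x'
  have hKle : K ≤ K₀ := eL.le_iff_le.mp hK'le
  have hxb : x ∈ D.block μ := by
    obtain ⟨y, hy, hyx⟩ := hblock μ hxb'
    rwa [← eH.injective hyx]
  have hxf : x ∈ fixedBy (Kof K) D.H := by
    intro k hk
    apply eH.injective
    rw [heH K k hk]
    exact hxf' (φ k) (hK K k hk)
  have h3 : eW K (res K x) ∈ (Submodule.span ℂ (cmCl K μ)).map (eW K) := ⟨_, hK₀ K hKle x hxb hxf, rfl⟩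
  rw [Submodule.map_span, hres] at h3
  exact Submodule.span_mono (hcm K μ) h3

/-- **`Thm418Combined` is INVARIANT under transport of all its data** (the two forms combined): along a group isomorphism
`φ : G ≃* G'` with `Kof' (eL K) = φ (Kof K)`, an order isomorphism of levels `eL`, a bijection of characters `eC` with `PhiMu μ ↔ PhiMu' (eC μ)`,
a `φ`-semilinear `ℂ`-linear isomorphism of carriers `eH` with `eH (block μ) = block' (eC μ)` (e.g. from `map_block_eq_of_transport`), and
`ℂ`-linear isomorphisms `eW K : W K ≃ W' (eL K)` with `eW K ∘ res K = res' (eL K) ∘ eH` and `cmCl' (eL K) (eC μ) = eW K '' cmCl K μ`,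
`D.Thm418Combined res cmCl ↔ D'.Thm418Combined res' cmCl'`. [folklore] -/
theorem thm418Combined_iff_of_transport [Preorder Lvl] [Preorder Lvl']
    (D : LiuAlbaneseModuleDatum G Kof) (D' : LiuAlbaneseModuleDatum G' Kof')
    {W : Lvl → Type w} [∀ K, AddCommGroup (W K)] [∀ K, Module ℂ (W K)]
    {W' : Lvl' → Type w'} [∀ K', AddCommGroup (W' K')] [∀ K', Module ℂ (W' K')]
    (res : ∀ K : Lvl, D.H →ₗ[ℂ] W K) (cmCl : ∀ K : Lvl, D.Char → Set (W K))
    (res' : ∀ K' : Lvl', D'.H →ₗ[ℂ] W' K') (cmCl' : ∀ K' : Lvl', D'.Char → Set (W' K'))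
    (φ : G ≃* G') (eL : Lvl ≃o Lvl') (eC : D.Char ≃ D'.Char) (eH : D.H ≃ₗ[ℂ] D'.H)
    (eW : ∀ K : Lvl, W K ≃ₗ[ℂ] W' (eL K))
    (hK : ∀ K : Lvl, Kof' (eL K) = (Kof K).map φ.toMonoidHom)
    (heH : ∀ (g : G) (x : D.H), eH (MonoidAlgebra.of ℂ G g • x) = MonoidAlgebra.of ℂ G' (φ g) • eH x)
    (hPhi : ∀ μ : D.Char, D.PhiMu μ ↔ D'.PhiMu (eC μ))
    (hblock : ∀ μ : D.Char, (D.block μ).map (eH : D.H →ₗ[ℂ] D'.H) = D'.block (eC μ))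
    (hres : ∀ (K : Lvl) (x : D.H), eW K (res K x) = res' (eL K) (eH x))
    (hcm : ∀ (K : Lvl) (μ : D.Char), cmCl' (eL K) (eC μ) = eW K '' cmCl K μ) :
    D.Thm418Combined res cmCl ↔ D'.Thm418Combined res' cmCl' := by
  constructor
  · refine thm418Combined_transport_of D D' res cmCl res' cmCl' φ eL eC eC.surjective eH
      (fun K => (eW K : W K →ₗ[ℂ] W' (eL K))) (fun K k hk => ?_) (fun K k _ x => heH k x)
      (fun μ => (hPhi μ).2) (fun μ => (hblock μ).ge) (fun K x => hres K x) (fun K μ => (hcm K μ).ge)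
    rw [hK K]
    exact ⟨k, hk, rfl⟩
  · refine thm418Combined_of_transport D D' res cmCl res' cmCl' φ eL eC (eH : D.H →ₗ[ℂ] D'.H)
      (fun K => (eW K : W K →ₗ[ℂ] W' (eL K))) (fun K₀' => ⟨eL.symm K₀', fun K hK => ?_⟩) (fun K k' hk' => ?_)
      (fun K k _ x => heH k x) (fun μ => (hPhi μ).1) (fun μ => (hblock μ).le) (fun K x => hres K x)
      (fun K => (eW K).injective) (fun K μ => (hcm K μ).le)
    · simpa using eL.monotone hK
    · rw [hK K] at hk'
      obtain ⟨k, hk, rfl⟩ := hk'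
      exact ⟨k, hk, rfl⟩

end Abstract

end HodgeCM.Literature.Theta.LiuAlbaneseModuleDatum.D2Bridge

/-! ## §2 The model's dictionaries: `Thm418C` transports between any two pins -/

namespace Summit.HodgeConjecture.CorCM.D2Bridge

open HodgeCM HodgeCM.Model
open HodgeCM.Literature.Theta HodgeCM.Literature.Theta.LiuAlbaneseModuleDatum
open HodgeCM.Literature.Theta.LiuAlbaneseModuleDatum.D2Bridge

variable {hHD : Literature.AlgebraicGeometry.HodgeTheory.exists_isReal_hodgeModel}
  {hI : Literature.AlgebraicGeometry.HodgeTheory.hodgePQ_independent_of_hodgeModel}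
  {h₁ : Literature.NumberTheory.Automorphic.PicardCM.BallQuotientUniformised}
  {h₃ : Literature.NumberTheory.Automorphic.PicardCM.CMAbelianVarietyRealised}

/-- **S-d, TRANSPORT FORM (two-sided).**  For real-carrier dictionaries `T₁`, `T₂` at two pins `(L₁, ι₁, V₁)`, `(L₂, ι₂, V₂)` of the
SAME end-state universe `U = picardCMUniverse hHD hI h₁ h₃`, the combined readings r8 are EQUIVALENT, `T₁.Thm418C ↔ T₂.Thm418C`, along:
an isomorphism of the finite-adélic unitary groups `φ : U(V₁)(𝔸_f) ≃* U(V₂)(𝔸_f)` and an order isomorphism of levels `eL` with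
`(eL K).K = φ (K.K)`; a bijection of characters `eC` matching `PhiMu`; a `φ`-semilinear `ℂ`-linear isomorphism of towers `eH : T₁.H ≃ T₂.H`
matching the `μ`-blocks; and per-level `ℂ`-linear isomorphisms `eW K : H¹(P_K(V₁); ℂ) ≃ H¹(P_{eL K}(V₂); ℂ)` (`U.CohC (U.pms …) 1`)
intertwining `res` and matching `cmClasses`.  At a conjugate pair `(V, ι₁)`, `(V̄, ῑ₁)` with `V̄.Hm = V.Hmᵀ` the pieces coincide
(`pmsCode` equality) and `eW K` is the cast; the other components are the Stage-1 relabeling along complex conjugation — DATA the caller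
supplies, not facts assumed here.  Immediate from `thm418Combined_iff_of_transport` (`Thm418C := Thm418Combined res cmClasses`). [folklore] -/
theorem thm418C_iff_of_transport {L₁ L₂ : HodgeCM.CMField} {ι₁ : (L₁ : Type) →+* ℂ} {ι₂ : (L₂ : Type) →+* ℂ}
    {V₁ : HodgeCM.HermSpace3 L₁ ι₁} {V₂ : HodgeCM.HermSpace3 L₂ ι₂}
    (T₁ : LiuDictionary hHD hI h₁ h₃ V₁) (T₂ : LiuDictionary hHD hI h₁ h₃ V₂)
    (φ : ↥V₁.adelicFin ≃* ↥V₂.adelicFin) (eL : HodgeCM.Level V₁ ≃o HodgeCM.Level V₂) (eC : T₁.Char ≃ T₂.Char)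
    (eH : T₁.H ≃ₗ[ℂ] T₂.H)
    (eW : ∀ K : HodgeCM.Level V₁,
      (picardCMUniverse hHD hI h₁ h₃).CohC ((picardCMUniverse hHD hI h₁ h₃).pms L₁ ι₁ V₁ K) 1 ≃ₗ[ℂ]
        (picardCMUniverse hHD hI h₁ h₃).CohC ((picardCMUniverse hHD hI h₁ h₃).pms L₂ ι₂ V₂ (eL K)) 1)
    (hK : ∀ K : HodgeCM.Level V₁, (eL K).K = K.K.map φ.toMonoidHom)
    (heH : ∀ (g : ↥V₁.adelicFin) (x : T₁.H),
      eH (MonoidAlgebra.of ℂ ↥V₁.adelicFin g • x) = MonoidAlgebra.of ℂ ↥V₂.adelicFin (φ g) • eH x)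
    (hPhi : ∀ μ : T₁.Char, T₁.PhiMu μ ↔ T₂.PhiMu (eC μ))
    (hblock : ∀ μ : T₁.Char, (T₁.block μ).map (eH : T₁.H →ₗ[ℂ] T₂.H) = T₂.block (eC μ))
    (hres : ∀ (K : HodgeCM.Level V₁) (x : T₁.H), eW K (T₁.res K x) = T₂.res (eL K) (eH x))
    (hcm : ∀ (K : HodgeCM.Level V₁) (μ : T₁.Char), T₂.cmClasses (eL K) (eC μ) = eW K '' T₁.cmClasses K μ) :
    T₁.Thm418C ↔ T₂.Thm418C :=
  thm418Combined_iff_of_transport T₁.toLiuAlbaneseModuleDatum T₂.toLiuAlbaneseModuleDatum T₁.res T₁.cmClasses T₂.res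
    T₂.cmClasses φ eL eC eH eW hK heH hPhi hblock hres hcm

/-- **S-d, TRANSPORT FORM (one-sided, the consumer's direction «carry `Thm418C` from the pin `(V₂, ι₂)` back to `(V₁, ι₁)`»).**  Only maps
OUT OF the `(V₁, ι₁)`-side are needed, with the weakest laws of `thm418Combined_of_transport`. [folklore] -/
theorem thm418C_of_transport {L₁ L₂ : HodgeCM.CMField} {ι₁ : (L₁ : Type) →+* ℂ} {ι₂ : (L₂ : Type) →+* ℂ}
    {V₁ : HodgeCM.HermSpace3 L₁ ι₁} {V₂ : HodgeCM.HermSpace3 L₂ ι₂}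
    (T₁ : LiuDictionary hHD hI h₁ h₃ V₁) (T₂ : LiuDictionary hHD hI h₁ h₃ V₂)
    (φ : ↥V₁.adelicFin → ↥V₂.adelicFin) (eL : HodgeCM.Level V₁ → HodgeCM.Level V₂) (eC : T₁.Char → T₂.Char)
    (eH : T₁.H →ₗ[ℂ] T₂.H)
    (eW : ∀ K : HodgeCM.Level V₁,
      (picardCMUniverse hHD hI h₁ h₃).CohC ((picardCMUniverse hHD hI h₁ h₃).pms L₁ ι₁ V₁ K) 1 →ₗ[ℂ]
        (picardCMUniverse hHD hI h₁ h₃).CohC ((picardCMUniverse hHD hI h₁ h₃).pms L₂ ι₂ V₂ (eL K)) 1)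
    (hcof : ∀ K₀' : HodgeCM.Level V₂, ∃ K₀ : HodgeCM.Level V₁, ∀ K ≤ K₀, eL K ≤ K₀')
    (hK : ∀ (K : HodgeCM.Level V₁), ∀ k' ∈ (eL K).K, ∃ k ∈ K.K, φ k = k')
    (heH : ∀ (K : HodgeCM.Level V₁), ∀ k ∈ K.K, ∀ x : T₁.H,
      eH (MonoidAlgebra.of ℂ ↥V₁.adelicFin k • x) = MonoidAlgebra.of ℂ ↥V₂.adelicFin (φ k) • eH x)
    (hPhi : ∀ μ : T₁.Char, T₁.PhiMu μ → T₂.PhiMu (eC μ))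
    (hblock : ∀ μ : T₁.Char, (T₁.block μ).map eH ≤ T₂.block (eC μ))
    (hres : ∀ (K : HodgeCM.Level V₁) (x : T₁.H), eW K (T₁.res K x) = T₂.res (eL K) (eH x))
    (hW : ∀ K : HodgeCM.Level V₁, Function.Injective (eW K))
    (hcm : ∀ (K : HodgeCM.Level V₁) (μ : T₁.Char), T₂.cmClasses (eL K) (eC μ) ⊆ eW K '' T₁.cmClasses K μ)
    (h : T₂.Thm418C) : T₁.Thm418C :=
  thm418Combined_of_transport T₁.toLiuAlbaneseModuleDatum T₂.toLiuAlbaneseModuleDatum T₁.res T₁.cmClasses T₂.res T₂.cmClasses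
    φ eL eC eH eW hcof hK heH hPhi hblock hres hW hcm h

/-- **NON-VACUITY WITNESS: the identity package.**  The laws of `thm418C_iff_of_transport` are jointly satisfiable — at `T₂ := T₁` by the
identity isomorphisms — so the transport form displays no uninhabitable hypothesis family. [folklore] -/
theorem thm418C_iff_of_transport_refl {L : HodgeCM.CMField} {ι₁ : (L : Type) →+* ℂ} {V : HodgeCM.HermSpace3 L ι₁}
    (T : LiuDictionary hHD hI h₁ h₃ V) : T.Thm418C ↔ T.Thm418C :=
  thm418C_iff_of_transport T T (MulEquiv.refl _) (OrderIso.refl _) (Equiv.refl _) (LinearEquiv.refl ℂ _)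
    (fun _ => LinearEquiv.refl ℂ _) (fun K => by ext g; simp) (fun _ _ => rfl) (fun _ => Iff.rfl)
    (fun μ => Submodule.map_id (T.block μ)) (fun _ _ => rfl) (fun K μ => (Set.image_id _).symm)

end Summit.HodgeConjecture.CorCM.D2Bridge

end
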